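import Literature.Probability.LatticeModels.RhombicEmbeddingTransfer
import HarnessLib

/-!
# Transport of tracks and of the printed square grid along a compatible map of sides

Common generalisation of the track bookkeeping of
`Literature.Probability.LatticeModels.RhombicEmbeddingTransfer` (relabelling vertices and faces)
and of `Literature.Probability.Percolation.IsoradialDualTracks` (passing to the dual): let
`emb₁ : RhombicEmbedding G₁ F₁`, `emb₂ : RhombicEmbedding G₂ F₂`, a bijection of edge sets
`E : E(G₁) ≃ E(G₂)` and an injective map of corner–centre pairs `σ : V₁ × F₁ → V₂ × F₂` such that
the sides of the rhombus of `E e` are the `σ`-images of the sides of the rhombus of `e` and `σ`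
intertwines the opposite-side maps. Then (`IsSideCompatible`):

* `IsSideCompatible.isTrack_iff` — `r` is a track of `emb₁` iff `E ∘ r` is a track of `emb₂`;
  `isSimpleTrack_iff`;
* `IsSideCompatible.isSquareGridGM`, `.squareGridPropertyGM`, `.hasSquareGridPropertyGM` — a
  printed square grid SGP(I) (Grimmett–Manolescu 2014, §4.2) of `emb₁` is carried by `E` to one
  of `emb₂` (clause (b) quantifies over all tracks: both directions of `isTrack_iff` are used);
  (for the converse direction apply the lemmas to the inverse data when available).

Used for restricting the face type to the faces that actually occur
(`Literature.Probability.Percolation.IsoradialUsedFaces`).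

## References

* G. R. Grimmett, I. Manolescu, *Bond percolation on isoradial graphs*, PTRF 159 (2014),
  arXiv:1204.0505, §4.2 (tracks, SGP(I)).
-/

noncomputable section

namespace Literature.Probability.LatticeModels

namespace RhombicEmbedding

variable {V₁ V₂ F₁ F₂ : Type*} {G₁ : SimpleGraph V₁} {G₂ : SimpleGraph V₂}
  [DecidableEq V₁] [DecidableEq F₁] [DecidableEq V₂] [DecidableEq F₂]

/-- **Side-compatibility** of an edge bijection `E` and an injective side map `σ` between two
rhombic embeddings: sides of corresponding rhombi correspond under `σ`, and `σ` intertwines the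
opposite-side maps on sides. [folklore] -/
structure IsSideCompatible (emb₁ : RhombicEmbedding G₁ F₁) (emb₂ : RhombicEmbedding G₂ F₂)
    (E : G₁.edgeSet ≃ G₂.edgeSet) (σ : V₁ × F₁ → V₂ × F₂) : Prop where
  /-- The side map is injective. -/
  injective : Function.Injective σ
  /-- Sides correspond. -/
  sides_eq : ∀ e : G₁.edgeSet, emb₂.sides (E e) = (emb₁.sides e).image σ
  /-- Opposite sides correspond (on sides). -/
  oppositeSide_eq : ∀ (e : G₁.edgeSet), ∀ p ∈ emb₁.sides e,
    σ (emb₁.oppositeSide e p) = emb₂.oppositeSide (E e) (σ p)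

namespace IsSideCompatible

variable {emb₁ : RhombicEmbedding G₁ F₁} {emb₂ : RhombicEmbedding G₂ F₂}
  {E : G₁.edgeSet ≃ G₂.edgeSet} {σ : V₁ × F₁ → V₂ × F₂}

/-- **Tracks correspond.** [cite: GrimmettManolescu2014Isoradial, §4.2 (tracks)] -/
theorem isTrack_iff (h : IsSideCompatible emb₁ emb₂ E σ) (r : ℤ → G₁.edgeSet) :
    emb₁.IsTrack r ↔ emb₂.IsTrack (E ∘ r) := by
  constructor
  · rintro ⟨s, hs⟩
    have hb : ∀ n, s (n - 1) ∈ emb₁.sides (r n) := fun n => by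
      have := (hs (n - 1)).2.1
      rwa [sub_add_cancel] at this
    refine ⟨σ ∘ s, fun n => ?_⟩
    obtain ⟨h1, h2, h3, h4⟩ := hs n
    refine ⟨?_, ?_, ?_, ?_⟩
    · rw [Function.comp_apply, h.sides_eq]; exact Finset.mem_image_of_mem σ h1
    · rw [Function.comp_apply, h.sides_eq]; exact Finset.mem_image_of_mem σ h2
    · exact fun h' => h3 (E.injective h')
    · change σ (s n) = emb₂.oppositeSide (E (r n)) (σ (s (n - 1)))
      rw [← h.oppositeSide_eq _ _ (hb n)]
      exact congrArg σ h4
  · rintro ⟨s₂, hs₂⟩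
    -- pull the sides back along `σ`
    have hex : ∀ n, ∃ p ∈ emb₁.sides (r n), σ p = s₂ n := fun n => by
      obtain ⟨h1, -, -, -⟩ := hs₂ n
      rw [Function.comp_apply, h.sides_eq, Finset.mem_image] at h1
      exact h1
    choose s hs hσs using hex
    have hb : ∀ n, s n ∈ emb₁.sides (r (n + 1)) := fun n => by
      obtain ⟨-, h2, -, -⟩ := hs₂ n
      rw [Function.comp_apply, h.sides_eq, Finset.mem_image] at h2
      obtain ⟨p, hp, hp'⟩ := h2
      have : p = s n := h.injective (hp'.trans (hσs n).symm)
      rw [← this]; exact hp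
    have hb' : ∀ n, s (n - 1) ∈ emb₁.sides (r n) := fun n => by
      have := hb (n - 1)
      rwa [sub_add_cancel] at this
    refine ⟨s, fun n => ⟨hs n, hb n, fun h' => (hs₂ n).2.2.1 (congrArg E h'), ?_⟩⟩
    apply h.injective
    rw [hσs n, (hs₂ n).2.2.2, Function.comp_apply, ← hσs (n - 1),
      h.oppositeSide_eq _ _ (hb' n)]

/-- **Simple tracks correspond.** [cite: GrimmettManolescu2014Isoradial, §4.2 (tracks)] -/
theorem isSimpleTrack_iff (h : IsSideCompatible emb₁ emb₂ E σ) (r : ℤ → G₁.edgeSet) :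
    emb₁.IsSimpleTrack r ↔ emb₂.IsSimpleTrack (E ∘ r) := by
  unfold IsSimpleTrack
  rw [h.isTrack_iff, E.injective.of_comp_iff]

/-- **A printed square grid is carried along a side-compatible edge bijection.**
(Grimmett–Manolescu 2014, §4.2, SGP(I).) [cite: GrimmettManolescu2014Isoradial, §4.2 (SGP(I))] -/
theorem isSquareGridGM (h : IsSideCompatible emb₁ emb₂ E σ) {s t : ℤ → ℤ → G₁.edgeSet} {I : ℕ}
    (hst : emb₁.IsSquareGridGM s t I) :
    emb₂.IsSquareGridGM (fun i => E ∘ s i) (fun j => E ∘ t j) I := by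
  have hg : Function.Injective E := E.injective
  have hback : ∀ r₀ : ℤ → G₂.edgeSet, r₀ = E ∘ (E.symm ∘ r₀) := fun r₀ => by
    funext n; simp
  refine ⟨fun i => ?_, fun j => ?_, ?_, ?_, fun i j => ?_, fun r₀ hr₀ hnr => ?_,
    fun r₀ hr₀ hnr => ?_, fun i j => ?_, fun i j => ?_⟩
  · exact (h.isSimpleTrack_iff _).1 (hst.isSimpleTrack_left i)
  · exact (h.isSimpleTrack_iff _).1 (hst.isSimpleTrack_right j)
  · intro i j hij
    rw [trackMeets_comp_iff hg]
    exact hst.pairwise_not_trackMeets_left hij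
  · intro i j hij
    rw [trackMeets_comp_iff hg]
    exact hst.pairwise_not_trackMeets_right hij
  · rw [isReparametrization_comp_iff hg]
    exact hst.not_isReparametrization i j
  · have hr : emb₁.IsTrack (E.symm ∘ r₀) := by
      rw [h.isTrack_iff, ← hback]; exact hr₀
    have hnr' : ∀ i, ¬ IsReparametrization (E.symm ∘ r₀) (s i) := fun i hi =>
      hnr i (by rw [hback r₀]; exact (isReparametrization_comp_iff hg _ _).2 hi)
    have := hst.crossesInOrder_left _ hr hnr'
    rw [hback r₀, crossesInOrder_comp_iff hg]
    exact this
  · have hr : emb₁.IsTrack (E.symm ∘ r₀) := by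
      rw [h.isTrack_iff, ← hback]; exact hr₀
    have hnr' : ∀ j, ¬ IsReparametrization (E.symm ∘ r₀) (t j) := fun j hj =>
      hnr j (by rw [hback r₀]; exact (isReparametrization_comp_iff hg _ _).2 hj)
    have := hst.crossesInOrder_right _ hr hnr'
    rw [hback r₀, crossesInOrder_comp_iff hg]
    exact this
  · simpa only [trackBetween_comp hg] using hst.encard_trackBetween_left_lt i j
  · simpa only [trackBetween_comp hg] using hst.encard_trackBetween_right_lt i j

/-- SGP(I) is carried along a side-compatible edge bijection. [cite: GrimmettManolescu2014Isoradial, §4.2 (SGP(I))] -/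
theorem squareGridPropertyGM (h : IsSideCompatible emb₁ emb₂ E σ) {I : ℕ}
    (h₁ : emb₁.SquareGridPropertyGM I) : emb₂.SquareGridPropertyGM I := by
  obtain ⟨s, t, hst⟩ := h₁
  exact ⟨_, _, h.isSquareGridGM hst⟩

/-- The printed square-grid property is carried along a side-compatible edge bijection.
[cite: GrimmettManolescu2014Isoradial, §4.2 (SGP(I))] -/
theorem hasSquareGridPropertyGM (h : IsSideCompatible emb₁ emb₂ E σ)
    (h₁ : emb₁.HasSquareGridPropertyGM) : emb₂.HasSquareGridPropertyGM := by
  obtain ⟨I, hI⟩ := h₁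
  exact ⟨I, h.squareGridPropertyGM hI⟩

/-- **Conversely, a printed square grid of `emb₂` pulls back along `E`** (both directions of
`isTrack_iff` being available). [cite: GrimmettManolescu2014Isoradial, §4.2 (SGP(I))] -/
theorem isSquareGridGM_symm (h : IsSideCompatible emb₁ emb₂ E σ) {s t : ℤ → ℤ → G₂.edgeSet}
    {I : ℕ} (hst : emb₂.IsSquareGridGM s t I) :
    emb₁.IsSquareGridGM (fun i => E.symm ∘ s i) (fun j => E.symm ∘ t j) I := by
  have hg : Function.Injective E.symm := E.symm.injective
  have hfwd : ∀ r : ℤ → G₂.edgeSet, E ∘ (E.symm ∘ r) = r := fun r => by funext n; simp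
  have hback : ∀ r₁ : ℤ → G₁.edgeSet, r₁ = E.symm ∘ (E ∘ r₁) := fun r₁ => by funext n; simp
  refine ⟨fun i => ?_, fun j => ?_, ?_, ?_, fun i j => ?_, fun r₁ hr₁ hnr => ?_,
    fun r₁ hr₁ hnr => ?_, fun i j => ?_, fun i j => ?_⟩
  · rw [h.isSimpleTrack_iff, hfwd]; exact hst.isSimpleTrack_left i
  · rw [h.isSimpleTrack_iff, hfwd]; exact hst.isSimpleTrack_right j
  · intro i j hij
    rw [trackMeets_comp_iff hg]
    exact hst.pairwise_not_trackMeets_left hij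
  · intro i j hij
    rw [trackMeets_comp_iff hg]
    exact hst.pairwise_not_trackMeets_right hij
  · rw [isReparametrization_comp_iff hg]
    exact hst.not_isReparametrization i j
  · have hr : emb₂.IsTrack (E ∘ r₁) := (h.isTrack_iff r₁).1 hr₁
    have hnr' : ∀ i, ¬ IsReparametrization (E ∘ r₁) (s i) := fun i hi =>
      hnr i (by rw [hback r₁, ← hfwd (s i)]
                exact (isReparametrization_comp_iff hg _ _).2 (by rw [hfwd]; exact hi))
    have := hst.crossesInOrder_left _ hr hnr'
    rw [hback r₁, crossesInOrder_comp_iff hg]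
    exact this
  · have hr : emb₂.IsTrack (E ∘ r₁) := (h.isTrack_iff r₁).1 hr₁
    have hnr' : ∀ j, ¬ IsReparametrization (E ∘ r₁) (t j) := fun j hj =>
      hnr j (by rw [hback r₁, ← hfwd (t j)]
                exact (isReparametrization_comp_iff hg _ _).2 (by rw [hfwd]; exact hj))
    have := hst.crossesInOrder_right _ hr hnr'
    rw [hback r₁, crossesInOrder_comp_iff hg]
    exact this
  · simpa only [trackBetween_comp hg] using hst.encard_trackBetween_left_lt i j
  · simpa only [trackBetween_comp hg] using hst.encard_trackBetween_right_lt i j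

/-- SGP(I) pulls back along a side-compatible edge bijection. [cite: GrimmettManolescu2014Isoradial, §4.2 (SGP(I))] -/
theorem squareGridPropertyGM_symm (h : IsSideCompatible emb₁ emb₂ E σ) {I : ℕ}
    (h₂ : emb₂.SquareGridPropertyGM I) : emb₁.SquareGridPropertyGM I := by
  obtain ⟨s, t, hst⟩ := h₂
  exact ⟨_, _, h.isSquareGridGM_symm hst⟩

/-- The printed square-grid property pulls back along a side-compatible edge bijection.
[cite: GrimmettManolescu2014Isoradial, §4.2 (SGP(I))] -/
theorem hasSquareGridPropertyGM_symm (h : IsSideCompatible emb₁ emb₂ E σ)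
    (h₂ : emb₂.HasSquareGridPropertyGM) : emb₁.HasSquareGridPropertyGM := by
  obtain ⟨I, hI⟩ := h₂
  exact ⟨I, h.squareGridPropertyGM_symm hI⟩

end IsSideCompatible

end RhombicEmbedding

end Literature.Probability.LatticeModels

end
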